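import Literature.NumberTheory.Automorphic.AutomorphicRepsGLCuspidalL2Step1Siegel
import Literature.NumberTheory.Automorphic.GLnCuspidalSiegelEstimate
import Literature.NumberTheory.Automorphic.AutomorphicRepsGLCuspidalSpectralSupportProofs
import Mathlib.Analysis.InnerProductSpace.Spectrum
import HarnessLib

/-!
# Step 1 of Borel–Jacquet 4.6 for `GL_n` holds: an irreducible `Π ≤ L²_cusp` contains a non-zero
# automorphic form (discharge of `AutomorphicRepsGL.formsOfL2_ne_bot`, without infinitesimal
# characters)

Topic `NumberTheory/Automorphic`; sibling proof file of `AutomorphicRepsGLCuspidalL2Step1` (which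
decomposed the named fact `AutomorphicRepsGL.formsOfL2_ne_bot hcpt μ` of
`AutomorphicRepsGLCuspidalL2` — Borel–Jacquet (1979), 4.6, Step 1: for an irreducible closed
invariant `Π ≤ L²_cusp(GL_n(K) A_G \ GL_n(𝔸_K), μ)` the space `V_Π` of automorphic forms
`g ↦ f [g⁻¹]`, `[f] ∈ Π`, is non-zero — into F1a, F1b, the basic estimate and F1d, the
infinitesimal character of `Z(𝔤)` on Gårding vectors). F1a, F1b, the basic estimate on a Siegel
set, reduction theory and the unimodularity of `GL_n(𝔸_K)` are theorems of the tree
(`exists_kFinite_garding_fixed_of_siegelEstimate`, `isArchSmooth_smoothedForm_holds`,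
`GLnCuspidalSpectrum.norm_smoothedForm_le_of_isSiegelSetGL_holds`, `reductionTheory_gl_holds`,
`GLn.isMulRightInvariant_of_isHaarMeasure_adelic_holds`); F1d (Segal–Mautner) is not. This file
PROVES `formsOfL2_ne_bot` WITHOUT F1d, replacing the infinitesimal character by the classical
eigenspace argument (Bump (1997), proof of Thm. 3.2.3, PDF p. 281: "`T ξ` lies in the
1-eigenspace of the compact operator `ρ(φ)`, which is finite dimensional"; Borel (1997), 2.3 (3)
and 2.5: `D (α ∗ β) = (D α) ∗ β` for `D ∈ Z(𝔤)`, i.e. `Z(𝔤)` commutes with the operators `R(η)`):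

* `isZFinite_invQuot_smoothedForm_of_eigenvector` (**proved**). Let `η` be a test function left
  invariant under a level `U`, `W ≤ L²` closed invariant, and `v ∈ W` with `R(η) v = v`, and suppose
  the `1`-eigenspace `E` of `T = R(η)|_W` is finite-dimensional. Then `φ = invQuot (S_η v)` is
  `Z(𝔤)`-finite. Indeed for a central word `p`, `p · φ = invQuot (S_{η_p} v)` (F1b along the free
  algebra, `applyFree_invQuot_smoothedForm`), the class of `S_{η_p} v` is `u_p = R(η_p) v`, and
  `u_p ∈ E`: on continuous representatives, `invQuot (S_η u_p) = ∫ η(h) (p · φ)(· h) dh`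
  (`invQuot_smoothedForm_toLp_eq_integral`) `= p · (∫ η(h) φ(· h) dh)` (`Z(𝔤)` commutes with right
  convolutions: `applyFree_convolution_eq_integral` and `applyFree_comp_mul_right_gl_of_isCentralWord`
  of `AutomorphicRepsGLCuspidalSpectralSupportProofs`) `= p · invQuot (S_η (R(η) v)) = p · φ =
  invQuot (S_{η_p} v)`, so `S_η u_p = S_{η_p} v` and `R(η) u_p = u_p`. Hence `p · φ = Φ(u_p)` for the
  linear map `Φ : E → (GL_n(𝔸_K) → ℂ)`, `u ↦ invQuot (S_η u)` (continuous representatives are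
  unique, `μ` charging open sets), and the `Z(𝔤)`-orbit span of `φ` lies in the finite-dimensional
  `Φ(E)`.
* `isAutomorphicForm_invQuot_smoothedForm_of_fixed` (**proved**): for `Π ≤ L²_cusp` irreducible,
  `η` a `U`-invariant test function and a `K_∞`-finite `v ∈ Π` with `R(η) v = v`, the function
  `g ↦ S_η v [g⁻¹]` is an automorphic form — as `isAutomorphicForm_invQuot_smoothedForm` of
  `…Step1` (left invariance, level `U`, F1b, `isKFinite_invQuot_smoothedForm`, moderate growth from the
  basic estimate `(9.13)`), with `Z(𝔤)`-finiteness from the previous theorem: `R(η)|_Π` is compact by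
  `(9.13)` (`isCompactOperator_smoothedVectorL_of_norm_le`), so its `1`-eigenspace is
  finite-dimensional (F. Riesz; Mathlib `ContinuousLinearMap.finite_dimensional_eigenspace`).
* `AutomorphicRepsGL.formsOfL2_ne_bot_holds` (**proved**, the discharge): F1a
  (`exists_kFinite_garding_fixed_of_siegelEstimate` with the proved basic estimate) gives `U`, `η`, `v`;
  the automorphic form `g ↦ S_η v [g⁻¹]` has class `R(η) v = v ∈ Π`, so it lies in `V_Π`, and it is
  non-zero because `v ≠ 0` (as in `formsOfL2_ne_bot_of`).

No definition, no named fact, no instance is introduced; everything here is proved. With this file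
the trust base of `formsOfL2_ne_bot` is empty, and that of `exists_cuspidalRepData_of_L2` loses F1d
on the Step-1 side (F1d is still consumed by Step 3 through `formsOfL2_hasZCharacter`).

## Design notes

* The eigenvalue is normalised to `1` (`R(η) v = v` is what F1a provides); self-adjointness of
  `R(η)` and the symmetry / `Ad K_∞`-invariance of the bump of `…Step1KFinite` are not needed here:
  the eigenspaces of any compact operator for non-zero eigenvalues are finite-dimensional.
* Linearity of `u ↦ S_η u` is used only on `E`, where `S_η u` is the continuous representative of
  `u`, so it follows from the uniqueness of continuous representatives (`Continuous.ae_eq_iff_eq`).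
* No local instances are needed (the measurable structure of `GL_n(𝔸_K)` is read off the type of
  `adelicHaar`); no `sorry`.

## References

* A. Borel, H. Jacquet, *Automorphic forms and automorphic representations*, Proc. Sympos. Pure
  Math. 33 (Corvallis 1977), Part 1 (1979), 189–202, §4.6 [BorelJacquet1979] (not held;
  doi:10.1090/pspum/033.1/546598).
* D. Bump, *Automorphic Forms and Representations* (1997), proofs of Thm. 3.2.2–3.2.3
  (PDF pp. 280–281 of the held copy) [Bump1997].
* A. Borel, *Automorphic forms on SL₂(ℝ)*, Cambridge Tracts in Math. 130 (1997), 2.3 (3), 2.5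
  (PDF pp. 14–15 of the held copy) [Borel1997].
* J. R. Getz, H. Hahn, *An Introduction to Automorphic Representations*, GTM 300 (2024), proof of
  Thm. 6.5.1 (printed p. 192), Lemma 9.8.2 (printed p. 191), Prop. 9.6.1 [GetzHahn2024].
-/

open scoped MatrixGroups Matrix ContDiff Classical Topology
open NumberField NumberField.mixedEmbedding IsDedekindDomain Filter Module.End
open _root_.MeasureTheory

noncomputable section

namespace Literature.NumberTheory.Automorphic

/-! ### 1. Continuous representatives of smoothed vectors and right convolutions -/

section Representatives

variable {n : ℕ} {K : Type} [Field K] [NumberField K]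
  {hcpt : isCompact_glFiniteIntegralLevel n K}
  {μ : Measure (AdelicGroupData.gl n K).automorphicQuotient}
  [(AdelicGroupData.gl n K).IsAutomorphicMeasure μ]
  (W : ContRepresentation.ClosedSubrep ((AdelicGroupData.gl n K).rightRegular μ))

/-- The continuous smoothed form `S_θ u` of `u ∈ W` is square-integrable (it represents the
smoothed vector `R(θ) u`, `smoothedVector_ae_eq`). [folklore] -/
theorem memLp_smoothedForm_coe {θ : (AdelicGroupData.gl n K).Adelic → ℝ} (hθ : Continuous θ)
    (hθs : HasCompactSupport θ) (u : W.toSubmodule) :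
    MemLp (smoothedForm θ ((u : W.toSubmodule) : (AdelicGroupData.gl n K).L2 μ)) 2 μ :=
  (Lp.memLp _).ae_eq (smoothedVector_ae_eq W hθ hθs u)

/-- The class of the continuous smoothed form `S_θ u` is the smoothed vector `R(θ) u`.
[folklore] -/
theorem toLp_smoothedForm_coe {θ : (AdelicGroupData.gl n K).Adelic → ℝ} (hθ : Continuous θ)
    (hθs : HasCompactSupport θ) (u : W.toSubmodule) :
    (memLp_smoothedForm_coe W hθ hθs u).toLp _ =
      ((smoothedVector W θ u : W.toSubmodule) : (AdelicGroupData.gl n K).L2 μ) := by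
  set V := ((smoothedVector W θ u : W.toSubmodule) : (AdelicGroupData.gl n K).L2 μ) with hV
  rw [← Lp.toLp_coeFn V (Lp.memLp V)]
  exact (MemLp.toLp_eq_toLp_iff _ (Lp.memLp V)).mpr (smoothedVector_ae_eq W hθ hθs u).symm

/-- **Smoothing a smoothed vector is right convolution of the continuous representative**:
`invQuot (S_{θ'} (R(θ) u)) (g) = ∫ θ'(h) · invQuot (S_θ u) (g h) dh` at every `g`
(`invQuot_smoothedForm_toLp_eq_integral` applied to the representative `S_θ u` of `R(θ) u`).
Borel (1997), 2.3; Borel–Jacquet (1979), 4.6. [folklore] -/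
theorem invQuot_smoothedForm_smoothedVector_eq_integral
    {θ : (AdelicGroupData.gl n K).Adelic → ℝ} (hθ : Continuous θ) (hθs : HasCompactSupport θ)
    (θ' : (AdelicGroupData.gl n K).Adelic → ℝ) (u : W.toSubmodule)
    (g : (AdelicGroupData.gl n K).Adelic) :
    invQuot (AdelicGroupData.gl n K) (smoothedForm θ'
        ((smoothedVector W θ u : W.toSubmodule) : (AdelicGroupData.gl n K).L2 μ)) g =
      ∫ h, (θ' h : ℂ) * invQuot (AdelicGroupData.gl n K)
        (smoothedForm θ ((u : W.toSubmodule) : (AdelicGroupData.gl n K).L2 μ)) (g * h)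
          ∂adelicHaar n K := by
  rw [← toLp_smoothedForm_coe W hθ hθs u]
  exact invQuot_smoothedForm_toLp_eq_integral θ' (memLp_smoothedForm_coe W hθ hθs u) g

omit [(AdelicGroupData.gl n K).IsAutomorphicMeasure μ] in
/-- **`Z(𝔤)` commutes with right convolutions** (Borel (1997), 2.3 (3) and 2.5:
`D (α ∗ β) = (D α) ∗ β`): for a central word `p`, `Φ` smooth in the archimedean variable and right
invariant under an admissible level, and `η₀ ∈ C_c(GL_n(𝔸_K))`,
`p · (g ↦ ∫ η₀(h) Φ(g h) dh) = g ↦ ∫ η₀(h) (p · Φ)(g h) dh` — `p` and `∫` permute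
(`applyFree_convolution_eq_integral`) and `p (r(h) Φ) = r(h) (p Φ)`
(`applyFree_comp_mul_right_gl_of_isCentralWord`). [cite: Borel1997, 2.3 (3) (PDF p. 14)] -/
theorem applyFree_convolution_of_isCentralWord {η₀ : (AdelicGroupData.gl n K).Adelic → ℝ}
    (hη₀ : Continuous η₀) (hη₀s : HasCompactSupport η₀)
    {Φ : (AdelicGroupData.gl n K).Adelic → ℂ}
    (hs : IsArchSmooth (AutomorphyDatum.gl n K hcpt).ofArch Φ)
    {U : Subgroup (AdelicGroupData.gl n K).Adelic}
    (hU : U ∈ (AutomorphyDatum.gl n K hcpt).finiteLevels) (hΦU : IsRightInvariantUnder U Φ)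
    {p : FreeAlgebra ℝ (AutomorphyDatum.gl n K hcpt).arch.lie} (hp : IsCentralWord p) :
    applyFree (AutomorphyDatum.gl n K hcpt).ofArch p
        (fun g => ∫ h, (η₀ h : ℂ) * Φ (g * h) ∂adelicHaar n K) =
      fun g => ∫ h, (η₀ h : ℂ) * applyFree (AutomorphyDatum.gl n K hcpt).ofArch p Φ (g * h)
        ∂adelicHaar n K := by
  funext g
  rw [applyFree_convolution_eq_integral hη₀ hη₀s hs hU hΦU p g]
  simp only [applyFree_comp_mul_right_gl_of_isCentralWord hp hs]

end Representatives

/-! ### 2. `Z(𝔤)`-finiteness from the finite-dimensional eigenspace of `R(η)` -/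

section ZFinite

variable {n : ℕ} {K : Type} [Field K] [NumberField K]
  {hcpt : isCompact_glFiniteIntegralLevel n K}
  {μ : Measure (AdelicGroupData.gl n K).automorphicQuotient}
  [(AdelicGroupData.gl n K).IsAutomorphicMeasure μ]
  (W : ContRepresentation.ClosedSubrep ((AdelicGroupData.gl n K).rightRegular μ))

/-- **`Z(𝔤)`-finiteness of the smoothed form of an `R(η)`-fixed vector, from the eigenspace of the
smoothing operator.** Let `η` be a test function left invariant under a level `U`, `W ≤ L²` a closed
invariant subspace whose operator `T = R(η)|_W` has a finite-dimensional `1`-eigenspace `E`, and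
`v ∈ W` with `R(η) v = v`. Then `φ = (g ↦ S_η v [g⁻¹])` is `Z(𝔤)`-finite: for a central word `p`,
`p · φ = invQuot (S_{η_p} v)` (F1b), whose class `u_p = R(η_p) v` lies again in `E` because `Z(𝔤)`
commutes with the right convolution by `η` (`applyFree_convolution_of_isCentralWord`:
`invQuot (S_η u_p) = ∫ η(h) (p · φ)(· h) dh = p · invQuot (S_η (R(η) v)) = p · φ`), so `p · φ` is the
continuous representative `invQuot (S_η u_p)` of `u_p ∈ E`, and these representatives form the
image of the finite-dimensional `E` under a linear map. Bump (1997), proof of Thm. 3.2.3 (PDF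
p. 281); Borel (1997), 2.3 (3), 2.5. [cite: Bump1997, proof of Thm. 3.2.3 (PDF p. 281)] -/
theorem isZFinite_invQuot_smoothedForm_of_eigenvector
    {η : (AdelicGroupData.gl n K).Adelic → ℝ} (hη : IsTestFunctionGL n K η)
    {U : Subgroup (AdelicGroupData.gl n K).Adelic}
    (hU : U ∈ (AutomorphyDatum.gl n K hcpt).finiteLevels) (hηU : ∀ u ∈ U, ∀ g, η (u * g) = η g)
    (hfin : FiniteDimensional ℂ
      (eigenspace (smoothedVectorL W hη.continuous hη.hasCompactSupport :
        Module.End ℂ W.toSubmodule) 1))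
    {v : W.toSubmodule} (hfix : smoothedVector W η v = v) :
    IsZFinite (AutomorphyDatum.gl n K hcpt).ofArch
      (invQuot (AdelicGroupData.gl n K)
        (smoothedForm η ((v : W.toSubmodule) : (AdelicGroupData.gl n K).L2 μ))) := by
  have h₂ := AutomorphicRepsGL.isArchSmooth_smoothedForm_holds hcpt μ
  have hηc : Continuous η := hη.continuous
  have hηs : HasCompactSupport η := hη.hasCompactSupport
  set T : W.toSubmodule →L[ℂ] W.toSubmodule := smoothedVectorL W hηc hηs with hT
  set E : Submodule ℂ W.toSubmodule := eigenspace (T : Module.End ℂ W.toSubmodule) 1 with hE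
  haveI : FiniteDimensional ℂ E := hfin
  -- membership in `E` is being fixed by `R(η)`
  have hmemE : ∀ u : W.toSubmodule, u ∈ E ↔ smoothedVector W η u = u := by
    intro u
    rw [hE, mem_eigenspace_iff, one_smul]
    rfl
  -- the continuous representative `S_η u` of `u ∈ E`
  have hcont : ∀ u : W.toSubmodule,
      Continuous (smoothedForm η ((u : W.toSubmodule) : (AdelicGroupData.gl n K).L2 μ)) :=
    fun u ↦ continuous_smoothedForm hηc hηs _
  have hrep : ∀ u : W.toSubmodule, u ∈ E →
      (((u : W.toSubmodule) : (AdelicGroupData.gl n K).L2 μ) :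
          (AdelicGroupData.gl n K).automorphicQuotient → ℂ) =ᵐ[μ]
        smoothedForm η ((u : W.toSubmodule) : (AdelicGroupData.gl n K).L2 μ) := by
    intro u hu
    have h := smoothedVector_ae_eq W hηc hηs u
    rwa [(hmemE u).1 hu] at h
  -- linearity of `u ↦ S_η u` on `E` (uniqueness of continuous representatives)
  have hadd : ∀ u u' : W.toSubmodule, u ∈ E → u' ∈ E →
      smoothedForm η (((u + u' : W.toSubmodule)) : (AdelicGroupData.gl n K).L2 μ) =
        smoothedForm η ((u : W.toSubmodule) : (AdelicGroupData.gl n K).L2 μ) +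
          smoothedForm η ((u' : W.toSubmodule) : (AdelicGroupData.gl n K).L2 μ) := by
    intro u u' hu hu'
    refine ((hcont _).ae_eq_iff_eq μ ((hcont u).add (hcont u'))).mp ?_
    have h1 := hrep _ (E.add_mem hu hu')
    have hcoe : (((u + u' : W.toSubmodule)) : (AdelicGroupData.gl n K).L2 μ) =
        ((u : W.toSubmodule) : (AdelicGroupData.gl n K).L2 μ) +
          ((u' : W.toSubmodule) : (AdelicGroupData.gl n K).L2 μ) := Submodule.coe_add u u'
    rw [hcoe] at h1 ⊢
    filter_upwards [h1, Lp.coeFn_add ((u : W.toSubmodule) : (AdelicGroupData.gl n K).L2 μ)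
      ((u' : W.toSubmodule) : (AdelicGroupData.gl n K).L2 μ), hrep u hu, hrep u' hu']
      with y hy1 hy2 hy3 hy4
    rw [← hy1, hy2, Pi.add_apply, Pi.add_apply, hy3, hy4]
  have hsmul : ∀ (c : ℂ) (u : W.toSubmodule), u ∈ E →
      smoothedForm η (((c • u : W.toSubmodule)) : (AdelicGroupData.gl n K).L2 μ) =
        c • smoothedForm η ((u : W.toSubmodule) : (AdelicGroupData.gl n K).L2 μ) := by
    intro c u hu
    refine ((hcont _).ae_eq_iff_eq μ ((hcont u).const_smul c)).mp ?_
    have h1 := hrep _ (E.smul_mem c hu)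
    have hcoe : (((c • u : W.toSubmodule)) : (AdelicGroupData.gl n K).L2 μ) =
        c • ((u : W.toSubmodule) : (AdelicGroupData.gl n K).L2 μ) := Submodule.coe_smul c u
    rw [hcoe] at h1 ⊢
    filter_upwards [h1, Lp.coeFn_smul c ((u : W.toSubmodule) : (AdelicGroupData.gl n K).L2 μ),
      hrep u hu] with y hy1 hy2 hy3
    rw [← hy1, hy2, Pi.smul_apply, Pi.smul_apply, hy3]
  -- the linear map `E → (GL_n(𝔸_K) → ℂ)`, `u ↦ invQuot (S_η u)`
  let L : E →ₗ[ℂ] ((AdelicGroupData.gl n K).Adelic → ℂ) :=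
    { toFun := fun u ↦ invQuot (AdelicGroupData.gl n K)
        (smoothedForm η (((u : W.toSubmodule)) : (AdelicGroupData.gl n K).L2 μ))
      map_add' := fun u u' ↦ by
        change invQuot (AdelicGroupData.gl n K) (smoothedForm η
          ((((u : W.toSubmodule) + (u' : W.toSubmodule) : W.toSubmodule)) :
            (AdelicGroupData.gl n K).L2 μ)) = _
        rw [hadd _ _ u.2 u'.2]
        rfl
      map_smul' := fun c u ↦ by
        change invQuot (AdelicGroupData.gl n K) (smoothedForm η
          (((c • (u : W.toSubmodule) : W.toSubmodule)) : (AdelicGroupData.gl n K).L2 μ)) = _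
        rw [hsmul c _ u.2, invQuot_const_smul]
        rfl }
  have hL : ∀ u : E, L u = invQuot (AdelicGroupData.gl n K)
      (smoothedForm η (((u : W.toSubmodule)) : (AdelicGroupData.gl n K).L2 μ)) := fun u ↦ rfl
  -- the form `φ` and its properties
  set V : (AdelicGroupData.gl n K).L2 μ := ((v : W.toSubmodule) : (AdelicGroupData.gl n K).L2 μ)
    with hV
  set φ : (AdelicGroupData.gl n K).Adelic → ℂ :=
    invQuot (AdelicGroupData.gl n K) (smoothedForm η V) with hφ
  have hφs : IsArchSmooth (AutomorphyDatum.gl n K hcpt).ofArch φ := ((h₂ hη).2 V).1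
  have hφU : IsRightInvariantUnder U φ := by
    intro u hu g
    simp only [hφ, invQuot_apply, mul_inv_rev]
    rw [← AdelicGroupData.smul_toAutomorphicQuotient]
    exact smoothedForm_smul hηU V (U.inv_mem hu) _
  -- `φ` is its own right convolution by `η`: `∫ η(h) φ(g h) dh = invQuot (S_η (R(η) v)) (g) = φ g`
  have hconvφ : (fun g => ∫ h, (η h : ℂ) * φ (g * h) ∂adelicHaar n K) = φ := by
    funext g
    rw [hφ, hV, ← invQuot_smoothedForm_smoothedVector_eq_integral W hηc hηs η v g, hfix]
  -- the key step: for a central word `p`, `u_p = R(η_p) v ∈ E` and `p · φ = invQuot (S_η u_p)`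
  have key : ∀ (p : FreeAlgebra ℝ (AutomorphyDatum.gl n K hcpt).arch.lie), IsCentralWord p →
      smoothedVector W (freeDerivWeight (AutomorphyDatum.gl n K hcpt).ofArch p η) v ∈ E ∧
        applyFree (AutomorphyDatum.gl n K hcpt).ofArch p φ =
          invQuot (AdelicGroupData.gl n K) (smoothedForm η
            ((smoothedVector W (freeDerivWeight (AutomorphyDatum.gl n K hcpt).ofArch p η) v :
              W.toSubmodule) : (AdelicGroupData.gl n K).L2 μ)) := by
    intro p hp
    obtain ⟨hpc, hps, happ⟩ := applyFree_invQuot_smoothedForm h₂ hη V p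
    set ηp := freeDerivWeight (AutomorphyDatum.gl n K hcpt).ofArch p η with hηp
    set up : W.toSubmodule := smoothedVector W ηp v with hup
    -- `invQuot (S_η u_p) = ∫ η(h) (p · φ)(g h) dh = p · (∫ η(h) φ(· h) dh) = p · φ = invQuot (S_{η_p} v)`
    have h1 : invQuot (AdelicGroupData.gl n K)
        (smoothedForm η ((up : W.toSubmodule) : (AdelicGroupData.gl n K).L2 μ)) =
        fun g => ∫ h, (η h : ℂ) * applyFree (AutomorphyDatum.gl n K hcpt).ofArch p φ (g * h)
          ∂adelicHaar n K := by
      funext g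
      rw [hup, invQuot_smoothedForm_smoothedVector_eq_integral W hpc hps η v g, happ]
    have h4 : invQuot (AdelicGroupData.gl n K)
        (smoothedForm η ((up : W.toSubmodule) : (AdelicGroupData.gl n K).L2 μ)) =
        invQuot (AdelicGroupData.gl n K) (smoothedForm ηp V) := by
      rw [h1, ← applyFree_convolution_of_isCentralWord hηc hηs hφs hU hφU hp, hconvφ, happ]
    have h5 : smoothedForm η ((up : W.toSubmodule) : (AdelicGroupData.gl n K).L2 μ) =
        smoothedForm ηp V :=
      invQuot_injective (AdelicGroupData.gl n K) h4
    -- hence `R(η) u_p = u_p`: both classes are represented by `S_{η_p} v`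
    have hA : smoothedVector W η up = up := by
      apply Subtype.ext
      refine Lp.ext ?_
      refine (smoothedVector_ae_eq W hηc hηs up).trans ?_
      rw [h5, hup, hV]
      exact (smoothedVector_ae_eq W hpc hps v).symm
    refine ⟨(hmemE up).2 hA, ?_⟩
    rw [happ, ← h5]
  -- the `Z(𝔤)`-orbit span of `φ` lies in the image of `E`
  unfold IsZFinite zOrbitSpan
  refine Submodule.finiteDimensional_of_le (S₂ := LinearMap.range L) (Submodule.span_le.mpr ?_)
  rintro _ ⟨p, hp, rfl⟩
  obtain ⟨hupE, heq⟩ := key p hp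
  refine ⟨⟨_, hupE⟩, ?_⟩
  rw [hL, heq]

end ZFinite

/-! ### 3. The automorphic form and the discharge of `formsOfL2_ne_bot` -/

section Discharge

variable {n : ℕ} {K : Type} [Field K] [NumberField K]
  {hcpt : isCompact_glFiniteIntegralLevel n K}
  {μ : Measure (AdelicGroupData.gl n K).automorphicQuotient}
  [(AdelicGroupData.gl n K).IsAutomorphicMeasure μ]

/-- **The smoothed form of an `R(η)`-fixed `K_∞`-finite cuspidal vector is an automorphic form**
(no infinitesimal character needed). For an irreducible closed invariant `Π ≤ L²_cusp`, a test
function `η` left invariant under a level `U`, and `v ∈ Π` with `R(η) v = v` whose `K_∞`-translates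
span a finite-dimensional space, `g ↦ S_η v [g⁻¹]` is an automorphic form for
`AutomorphyDatum.gl n K hcpt`: left `GL_n(K)`-invariant, right `U`-invariant, smooth in the
archimedean variable (F1b, `isArchSmooth_smoothedForm_holds`), `K_∞`-finite
(`isKFinite_invQuot_smoothedForm`), of moderate growth (bounded by `C_η ‖v‖₂`, the basic estimate
`(9.13)` from `norm_smoothedForm_le_of_isSiegelSetGL_holds` and `reductionTheory_gl_holds`), and
`Z(𝔤)`-finite by `isZFinite_invQuot_smoothedForm_of_eigenvector`, the `1`-eigenspace of the compact
operator `R(η)|_Π` (`isCompactOperator_smoothedVectorL_of_norm_le`, `(9.13)`) being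
finite-dimensional (`ContinuousLinearMap.finite_dimensional_eigenspace`). Bump (1997), proofs of
Thm. 3.2.2–3.2.3 (PDF pp. 280–281); Getz–Hahn (2024), proof of Thm. 6.5.1 (printed p. 192);
Borel–Jacquet (1979), 4.6. [cite: Bump1997, proof of Thm. 3.2.3 (PDF p. 281)] -/
theorem isAutomorphicForm_invQuot_smoothedForm_of_fixed (P : CuspidalAutomorphicRepGL n K μ)
    {U : Subgroup (AdelicGroupData.gl n K).Adelic}
    (hU : U ∈ (AutomorphyDatum.gl n K hcpt).finiteLevels)
    {η : (AdelicGroupData.gl n K).Adelic → ℝ} (hη : IsTestFunctionGL n K η)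
    (hηU : ∀ u ∈ U, ∀ g, η (u * g) = η g) {v : P.1.toSubmodule}
    (hfix : smoothedVector P.1 η v = v)
    (hfin : FiniteDimensional ℂ (Submodule.span ℂ (Set.range
      fun k : (AutomorphyDatum.gl n K hcpt).arch.maximalCompact ↦
        P.1.toContRep ((AutomorphyDatum.gl n K hcpt).ofK k) v))) :
    IsAutomorphicForm (AutomorphyDatum.gl n K hcpt)
      (invQuot (AdelicGroupData.gl n K)
        (smoothedForm η ((v : P.1.toSubmodule) : (AdelicGroupData.gl n K).L2 μ))) := by
  have h₂ := AutomorphicRepsGL.isArchSmooth_smoothedForm_holds hcpt μ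
  set V : (AdelicGroupData.gl n K).L2 μ := ((v : P.1.toSubmodule) : (AdelicGroupData.gl n K).L2 μ)
    with hV
  -- `v` is cuspidal, whence the bound of the basic estimate `(9.13)`
  have hVcusp : V ∈ cuspidalSubspace n K μ := P.le_cuspidalSubspace v.2
  obtain ⟨C, hC⟩ := GLnCuspidalSpectrum.norm_smoothedForm_le_of_reductionTheory
    (GLnCuspidalSpectrum.norm_smoothedForm_le_of_isSiegelSetGL_holds n K μ)
    (reductionTheory_gl_holds n K) hη
  have hbound : ∀ x, ‖smoothedForm η V x‖ ≤ C * ‖V‖ := fun x ↦ hC V hVcusp x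
  -- `R(η)|_Π` is compact, so its `1`-eigenspace is finite-dimensional
  have hTc : IsCompactOperator (smoothedVectorL P.1 hη.continuous hη.hasCompactSupport) :=
    isCompactOperator_smoothedVectorL_of_norm_le P.1 hη.continuous hη.hasCompactSupport
      fun g hg x => hC g (P.le_cuspidalSubspace hg) x
  have hE : FiniteDimensional ℂ (eigenspace
      (smoothedVectorL P.1 hη.continuous hη.hasCompactSupport : Module.End ℂ P.1.toSubmodule) 1) :=
    ContinuousLinearMap.finite_dimensional_eigenspace hTc 1 one_ne_zero
  refine ⟨isLeftInvariant_invQuot _ _, ⟨U, hU, fun u hu g ↦ ?_⟩, ((h₂ hη).2 V).1,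
    isKFinite_invQuot_smoothedForm P.1 hη.continuous hη.hasCompactSupport hfix hbound hfin,
    isZFinite_invQuot_smoothedForm_of_eigenvector P.1 hη hU hηU hE hfix,
    ⟨C * ‖V‖, 0, fun g ↦ ?_⟩⟩
  · -- right `U`-invariance from left `U`-invariance of the weight
    simp only [invQuot_apply, mul_inv_rev]
    rw [← AdelicGroupData.smul_toAutomorphicQuotient]
    exact smoothedForm_smul hηU V (U.inv_mem hu) _
  · -- moderate growth: bounded
    rw [pow_zero, mul_one, invQuot_apply]
    exact hbound _

variable (hcpt μ) in
/-- **Step 1 of Borel–Jacquet (1979), 4.6 for `GL_n` holds** (discharge of the named fact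
`AutomorphicRepsGL.formsOfL2_ne_bot hcpt μ` of `AutomorphicRepsGLCuspidalL2`): for every irreducible
closed invariant subspace `Π ≤ L²_cusp(GL_n(𝔸_K) ⧸ A_G GL_n(K), μ)` the space `V_Π` of automorphic
forms `g ↦ f [g⁻¹]`, `[f] ∈ Π`, is non-zero. F1a (`exists_kFinite_garding_fixed_of_siegelEstimate`
with the proved basic estimate) gives a level `U`, a `U`-invariant test function `η` and a non-zero
`K_∞`-finite `v ∈ Π` with `R(η) v = v`; the automorphic form `g ↦ S_η v [g⁻¹]`
(`isAutomorphicForm_invQuot_smoothedForm_of_fixed`) has class `R(η) v = v ∈ Π`, so it lies in `V_Π`,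
and it is non-zero because `v ≠ 0`. Borel–Jacquet (1979), 4.6; Bump (1997), proofs of
Thm. 3.2.2–3.2.3 (PDF pp. 280–281); Getz–Hahn (2024), proof of Thm. 6.5.1 (printed p. 192).
[cite: BorelJacquet1979, 4.6] -/
theorem AutomorphicRepsGL.formsOfL2_ne_bot_holds : AutomorphicRepsGL.formsOfL2_ne_bot hcpt μ := by
  intro P
  obtain ⟨U, hU, η, hη, hηU, v, hv0, hfix, hfin⟩ :=
    AutomorphicRepsGL.exists_kFinite_garding_fixed_of_siegelEstimate (hcpt := hcpt)
      (GLnCuspidalSpectrum.norm_smoothedForm_le_of_isSiegelSetGL_holds n K μ) P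
  set V : (AdelicGroupData.gl n K).L2 μ := ((v : P.1.toSubmodule) : (AdelicGroupData.gl n K).L2 μ)
    with hV
  set φ₀ : (AdelicGroupData.gl n K).automorphicQuotient → ℂ := smoothedForm η V with hφ₀
  have hae : (V : (AdelicGroupData.gl n K).automorphicQuotient → ℂ) =ᵐ[μ] φ₀ := by
    have h := smoothedVector_ae_eq P.1 hη.continuous hη.hasCompactSupport v
    rwa [hfix] at h
  have hmem : MemLp φ₀ 2 μ := (Lp.memLp V).ae_eq hae
  have htoLp : hmem.toLp φ₀ = V := by
    rw [← Lp.toLp_coeFn V (Lp.memLp V)]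
    exact (MemLp.toLp_eq_toLp_iff hmem (Lp.memLp V)).mpr hae.symm
  have hP : hmem.toLp φ₀ ∈ P.1 := by
    rw [htoLp, ← ContRepresentation.ClosedSubrep.mem_toSubmodule]
    exact v.2
  have hauto := isAutomorphicForm_invQuot_smoothedForm_of_fixed P hU hη hηU hfix hfin
  have hφ : invQuot (AdelicGroupData.gl n K) φ₀ ∈ formsOfL2 hcpt μ P.1 :=
    invQuot_mem_formsOfL2 hmem hP hauto
  rw [Submodule.ne_bot_iff]
  refine ⟨invQuot (AdelicGroupData.gl n K) φ₀, hφ, fun h0 ↦ hv0 ?_⟩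
  have hφ₀0 : φ₀ = 0 :=
    invQuot_injective (AdelicGroupData.gl n K) (by rw [h0]; funext g; simp [invQuot_apply])
  have hV0 : V = 0 := by
    rw [← htoLp]
    refine Lp.ext ?_
    refine (MemLp.coeFn_toLp hmem).trans ?_
    rw [hφ₀0]
    exact (Lp.coeFn_zero ℂ 2 μ).symm
  exact Subtype.ext (by simpa [hV] using hV0)

end Discharge

end Literature.NumberTheory.Automorphic
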